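import Summits.AnomalousDissipation.AnomalousDissipation.Theorems.BaireTransferRobustLoudUpgradeLine
import Summits.AnomalousDissipation.AnomalousDissipation.Theorems.BaireTransferRobustLoudUpgradeStubSteadyPersist
import Summits.AnomalousDissipation.AnomalousDissipation.Theorems.BaireTransferRobustLoudUpgradeStubPeriodicWindow
import Summits.AnomalousDissipation.AnomalousDissipation.Theorems.BaireTransferRobustLoudUpgradePeriodicPersistOfHenry
import Literature.Analysis.FluidPDE.PeriodicNSOrbitPersistsProofs
import Literature.Analysis.FluidPDE.LongTimeAverageNonneg

/-!
# Stub `stub_budgetLimit` of the line `malkin-cone-group-orbits`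
# (crux stmt-AnomalousDissipation-1144, `BaireTransfer.RobustLoudUpgrade`, lead c16 reshape:
# lattice-tempered windows)

Closed budget inequalities pass to lattice limits.  Let `u` be a jointly smooth `τ`-periodic field on
`ℝ × T³` whose space–time lattice data `û = 𝓕(timeRoll τ u − ∫u(0))` is `x/Λ` for a state `x` of the
state space `W ⊂ ℓ²(ℤ × ℤ³; ℂ³)`, and let `uᵢ` be jointly smooth `τᵢ`-periodic fields with lattice data
`xᵢ/Λ`, `xᵢ → x` in norm, means `∫uᵢ(0) → ∫u(0)`, viscosities `νᵢ → ν > 0` and budgets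
`⟨‖uᵢ‖²⟩ ≤ E`, `ε ≤ ⟨νᵢ‖∇uᵢ‖²⟩`.  Then `⟨‖u‖²⟩ ≤ E` and `ε ≤ ⟨ν‖∇u‖²⟩`.

Proof.  The difference of the two rolled-up mean-free fields,
`D = (timeRoll τ u − ∫u(0)) − (timeRoll τᵢ uᵢ − ∫uᵢ(0)) : T⁴ → ℝ³`, is smooth with space–time
coefficients `(x − xᵢ)/Λ`, so the slice `H¹` bound `TimePeriodicLattice.slice_h1_le` gives, for every
circle time, `∫‖D(c,·)‖² + ‖∇D(c,·)‖₂² ≤ 3(1+4π²)‖x − xᵢ‖²`; the slice at `c = t/τ` is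
`(u(t) − ∫u(0)) − (uᵢ(τᵢt/τ) − ∫uᵢ(0))`, whence uniformly in `t`
`∫‖u(t) − uᵢ(τᵢt/τ)‖² ≤ 6(1+4π²)‖x − xᵢ‖² + 2‖∫u(0) − ∫uᵢ(0)‖² =: δᵢ → 0` and
`‖∇(u(t) − uᵢ(τᵢt/τ))‖₂² ≤ δᵢ` (gradients ignore constants).  The Peter–Paul transfer lemmas
`PeriodicWindow.meanEnergy_le_of_close` / `PeriodicWindow.meanDissipation_ge_of_close` then give, for
every `η > 0`, `⟨‖u‖²⟩ ≤ (1+η)E + (1+η⁻¹)δᵢ` and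
`(1+η)⁻¹((ν/νᵢ)ε − ν(1+η⁻¹)δᵢ) ≤ ⟨ν‖∇u‖²⟩` (using `⟨ν‖∇uᵢ‖²⟩ = (ν/νᵢ)⟨νᵢ‖∇uᵢ‖²⟩`,
`PeriodicWindow.meanDissipation_eq_period_mean`); let `i → ∞`, then `η → 0`.

References: G. Iooss, Arch. Rational Mech. Anal. 47 (1972), §2 (the embedding of the maximal-regularity
class into `C(S¹; H¹)`, here `slice_h1_le`); the template
`Literature/Analysis/FluidPDE/PeriodicNSOrbitPersistsProofs.lean` (`persists_main`, closeness step) and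
`Theorems/BaireTransferRobustLoudUpgradeStubPeriodicWindow.lean` (transfer of budgets).
-/

set_option linter.dupNamespace false

noncomputable section

open scoped BigOperators Topology ENNReal NNReal ComplexConjugate
open Filter Set Function TopologicalSpace MeasureTheory UnitAddTorus

namespace Summit.AnomalousDissipation.AnomalousDissipation.Theorems.RobustLoudUpgrade.Tempered

open Literature.Analysis.FunctionSpaces Literature.Analysis.FunctionSpaces.Torus
open Literature.Analysis.FunctionSpaces.EuclideanSpace
open Literature.Analysis.FluidPDE Literature.Analysis.FluidPDE.ScalarFourier
open Literature.Analysis.FluidPDE.TimePeriodicLattice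
open Summit.AnomalousDissipation.AnomalousDissipation.Theses.BaireTransfer
open Summit.AnomalousDissipation.AnomalousDissipation.Theorems.RobustLoudUpgrade

-- NOTATION START (verbatim the local notations of `Literature/Analysis/FluidPDE/PeriodicNSOrbitPersistsProofs.lean`)
/-- The flat unit torus `T³`. -/
local notation "𝕋³" => UnitAddTorus (Fin 3)
/-- Real velocity values. -/
local notation "ℝ³" => EuclideanSpace ℝ (Fin 3)
/-- Complex coefficient values. -/
local notation "ℂ³" => EuclideanSpace ℂ (Fin 3)

/-- Local notation: the parabolic weight `Λ(n, k) = |n| + |k|²`. -/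
local notation:max "Λ" m:max => (|((Prod.fst m : ℤ) : ℝ)| + freqNormSq (Prod.snd m))

/-- Local notation: the convective symbol on `ℤ × ℤ³` (as in `TimePeriodicNSLattice`). -/
local notation:max "𝐍[" a ", " b "]" m:max =>
  (WithLp.toLp 2 (fun p : Fin 3 => ∑ j : Fin 3, ∑' m' : ℤ × (Fin 3 → ℤ),
    a m' j * (dsym j (Prod.snd m - Prod.snd m') * b (m - m') p)) : EuclideanSpace ℂ (Fin 3))

/-- Local notation: division by the weight. -/
local notation:max "𝐜" x:max => (fun mm : ℤ × (Fin 3 → ℤ) =>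
  ((((|((Prod.fst mm : ℤ) : ℝ)| + freqNormSq (Prod.snd mm))⁻¹ : ℝ) : ℂ) • x mm))

/-- Local notation: multiplication by the weight. -/
local notation:max "𝐬" x:max => (fun mm : ℤ × (Fin 3 → ℤ) =>
  ((((|((Prod.fst mm : ℤ) : ℝ)| + freqNormSq (Prod.snd mm)) : ℝ) : ℂ) • x mm))

/-- Local notation: the family of coefficients of `x ∈ W ⊂ ℓ²`. -/
local notation:max "𝐰" x:max =>
  (((x : lp (fun _ : ℤ × (Fin 3 → ℤ) => EuclideanSpace ℂ (Fin 3)) 2)) : ℤ × (Fin 3 → ℤ) → EuclideanSpace ℂ (Fin 3))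

/-- Local notation: the symbol `σ_om(n,k) = 2πi om n + 4π²ν|k|² + 2πi m₀·k`. -/
local notation "σ[" om ", " ν ", " m₀ "]" => (fun mm : ℤ × (Fin 3 → ℤ) =>
  2 * Real.pi * Complex.I * ((om : ℝ) : ℂ) * ((Prod.fst mm : ℤ) : ℂ) +
    (((4 * Real.pi ^ 2 * ν * freqNormSq (Prod.snd mm) : ℝ)) : ℂ) +
    2 * Real.pi * Complex.I * (∑ jj : Fin 3, ((m₀ jj : ℝ) : ℂ) * (((Prod.snd mm) jj : ℤ) : ℂ)))

/-- Local notation: the lattice family of the orbit `u` with period `τ`: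
`û(n,k) = 𝓕(complexify ∘ (timeRoll τ u − ∫ u(0)))(n,k)`. -/
local notation:max "𝐨[" τ ", " u "]" => (fun mm : ℤ × (Fin 3 → ℤ) =>
  mFourierCoeff (EuclideanSpace.complexify ∘ fun y : UnitAddTorus (Fin 4) => Torus.timeRoll τ u y - ∫ x, u 0 x)
    (Fin.cons (Prod.fst mm) (Prod.snd mm) : Fin 4 → ℤ))

/-- Local notation: the force family `y_F(n,k) = [k ≠ 0][n = 0] 𝓕(complexify ∘ F)(k)`. -/
local notation:max "𝐲" F:max => (fun mm : ℤ × (Fin 3 → ℤ) =>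
  (ite (Prod.snd mm = 0) (0 : EuclideanSpace ℂ (Fin 3))
    (ite (Prod.fst mm = 0) (mFourierCoeff (EuclideanSpace.complexify ∘ F) (Prod.snd mm)) 0)))
-- NOTATION END

variable {W : Submodule ℝ (lp (fun _ : ℤ × (Fin 3 → ℤ) => EuclideanSpace ℂ (Fin 3)) 2)}

namespace BudgetLimitAux

/-! ## Elementary limits: `η → 0⁺` in the Peter–Paul slack -/

/-- If `a ≤ (1 + η) E` for every `η > 0` then `a ≤ E` (let `η → 0⁺`). [folklore] -/
theorem le_of_forall_le_one_add_mul {a E : ℝ} (h : ∀ η : ℝ, 0 < η → a ≤ (1 + η) * E) : a ≤ E := by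
  have ht : Tendsto (fun η : ℝ => (1 + η) * E) (𝓝[>] 0) (𝓝 E) := by
    have h0 : Tendsto (fun η : ℝ => (1 + η) * E) (𝓝 0) (𝓝 ((1 + 0) * E)) :=
      ((continuous_const.add continuous_id).mul continuous_const).tendsto' _ _ rfl
    rw [add_zero, one_mul] at h0
    exact h0.mono_left nhdsWithin_le_nhds
  exact ge_of_tendsto ht (eventually_nhdsWithin_of_forall fun η hη => h η hη)

/-- If `(1 + η)⁻¹ ε ≤ b` for every `η > 0` then `ε ≤ b` (let `η → 0⁺`). [folklore] -/
theorem le_of_forall_inv_one_add_mul_le {ε b : ℝ} (h : ∀ η : ℝ, 0 < η → (1 + η)⁻¹ * ε ≤ b) :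
    ε ≤ b := by
  refine le_of_forall_le_one_add_mul fun η hη => ?_
  have hη1 : 0 < 1 + η := by linarith
  rw [← inv_mul_le_iff₀ hη1]
  exact h η hη

/-! ## Gradients ignore constants; energies of fields differing by a constant -/

/-- `‖∇(v + g)‖₂² = ‖∇g‖₂²` for a constant vector `v`. [folklore] -/
theorem gradNormSq_const_add (v : ℝ³) (g : 𝕋³ → ℝ³) : gradNormSq (fun z => v + g z) = gradNormSq g := by
  unfold gradNormSq
  simp_rw [partialDeriv_const_add]

/-- `∫‖v + g‖² ≤ 2∫‖g‖² + 2‖v‖²` on the probability space `T³`, for continuous `g` and a constant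
vector `v`. [folklore] -/
theorem integral_norm_sq_const_add_le (v : ℝ³) {g : 𝕋³ → ℝ³} (hg : Continuous g) :
    ∫ z, ‖v + g z‖ ^ 2 ≤ 2 * (∫ z, ‖g z‖ ^ 2) + 2 * ‖v‖ ^ 2 := by
  have h := SteadyWindow.integral_norm_sq_le (u₀ := g) (u' := fun z => v + g z) hg (continuous_const.add hg) one_pos
  have hc : (∫ z : 𝕋³, ‖(v + g z) - g z‖ ^ 2) = ‖v‖ ^ 2 := by
    simp only [add_sub_cancel_right, integral_const, probReal_univ, one_smul]
  rw [hc] at h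
  norm_num at h
  exact h

/-! ## Rescaling the viscosity in the mean dissipation of a periodic field -/

/-- `⟨ν‖∇u‖²⟩ = (ν/ν') ⟨ν'‖∇u‖²⟩` for a smooth periodic field and `ν' ≠ 0`. [folklore] -/
theorem meanDissipation_rescale {τ : ℝ} {u : ℝ → 𝕋³ → ℝ³} (hu : IsSmoothSpaceTimeOn univ u)
    (hper : Function.Periodic u τ) (hτ : 0 < τ) {ν ν' : ℝ} (hν' : ν' ≠ 0) :
    meanDissipation ν u = (ν / ν') * meanDissipation ν' u := by
  rw [PeriodicWindow.meanDissipation_eq_period_mean hu hper hτ ν,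
    PeriodicWindow.meanDissipation_eq_period_mean hu hper hτ ν']
  field_simp

/-! ## Uniform-in-time closeness of two orbits from the distance of their lattice states -/

/-- **Closeness of orbits from closeness of states**: if `u` (`τ`-periodic) and `u'` (`τ'`-periodic) are
jointly smooth with lattice data `x/Λ`, `x'/Λ` for states `x, x' ∈ W`, then for every real time `t`
`∫‖u(t) − u'(τ't/τ)‖² ≤ 6(1+4π²)‖x − x'‖² + 2‖∫u(0) − ∫u'(0)‖²` and
`‖∇(u(t) − u'(τ't/τ))‖₂² ≤ 3(1+4π²)‖x − x'‖²` (the slice `H¹` bound `slice_h1_le` for the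
difference of the rolled-up mean-free fields, whose coefficients are `(x − x')/Λ`). [folklore] -/
theorem close_of_states
    (hW : ∀ x : lp (fun _ : ℤ × (Fin 3 → ℤ) => EuclideanSpace ℂ (Fin 3)) 2, x ∈ W ↔
      (∀ n : ℤ, (x : ℤ × (Fin 3 → ℤ) → EuclideanSpace ℂ (Fin 3)) (n, 0) = 0) ∧
      (∀ mm : ℤ × (Fin 3 → ℤ), (∑ jj : Fin 3, ((mm.2 jj : ℤ) : ℂ) *
        ((x : ℤ × (Fin 3 → ℤ) → EuclideanSpace ℂ (Fin 3)) mm) jj) = 0) ∧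
      (∀ mm : ℤ × (Fin 3 → ℤ), (x : ℤ × (Fin 3 → ℤ) → EuclideanSpace ℂ (Fin 3)) (-mm) =
        conjVec ((x : ℤ × (Fin 3 → ℤ) → EuclideanSpace ℂ (Fin 3)) mm)))
    {τ τ' : ℝ} (hτ : 0 < τ) {u u' : ℝ → 𝕋³ → ℝ³} (hu : IsSmoothSpaceTimeOn Set.univ u)
    (hper : Function.Periodic u τ) (hu' : IsSmoothSpaceTimeOn Set.univ u') (hper' : Function.Periodic u' τ')
    (x x' : W) (hx : 𝐨[τ, u] = 𝐜 (𝐰 x)) (hx' : 𝐨[τ', u'] = 𝐜 (𝐰 x')) (t : ℝ) :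
    (∫ z, ‖u t z - u' (τ' / τ * t) z‖ ^ 2) ≤
        2 * (3 * (1 + 4 * Real.pi ^ 2) * ‖x - x'‖ ^ 2) + 2 * ‖(∫ y, u 0 y) - ∫ y, u' 0 y‖ ^ 2 ∧
      gradNormSq (fun z => u t z - u' (τ' / τ * t) z) ≤ 3 * (1 + 4 * Real.pi ^ 2) * ‖x - x'‖ ^ 2 := by
  -- the rolled-up mean-free fields and their difference
  have hV : IsSmooth (fun y : UnitAddTorus (Fin 4) => timeRoll τ u y - ∫ y, u 0 y) :=
    (isSmooth_timeRoll hu hper).sub (isSmooth_const _)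
  have hV' : IsSmooth (fun y : UnitAddTorus (Fin 4) => timeRoll τ' u' y - ∫ y, u' 0 y) :=
    (isSmooth_timeRoll hu' hper').sub (isSmooth_const _)
  obtain ⟨D, hDdef⟩ : ∃ D : UnitAddTorus (Fin 4) → ℝ³,
      D = fun y => (timeRoll τ u y - ∫ y, u 0 y) - (timeRoll τ' u' y - ∫ y, u' 0 y) := ⟨_, rfl⟩
  have hD : IsSmooth D := by rw [hDdef]; exact hV.sub hV'
  -- its coefficients are `(x − x')/Λ`
  have he0 : ∀ n : ℤ, (𝐰 ((x - x' : W))) (n, 0) = 0 := W_zero hW _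
  have he2 : ∑' m, ‖(𝐰 ((x - x' : W))) m‖ₑ ^ 2 ≠ ⊤ := l2_tsum_enorm_sq_ne_top _
  have he : ∀ m : ℤ × (Fin 3 → ℤ),
      mFourierCoeff (complexify ∘ D) (Fin.cons m.1 m.2) = (𝐜 (𝐰 ((x - x' : W)))) m := by
    intro m
    have hsplit : (complexify ∘ D) = (complexify ∘ fun y : UnitAddTorus (Fin 4) => timeRoll τ u y - ∫ y, u 0 y) -
        (complexify ∘ fun y : UnitAddTorus (Fin 4) => timeRoll τ' u' y - ∫ y, u' 0 y) := by
      funext y; simp [hDdef]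
    have hVc : IsSmooth (complexify ∘ fun y : UnitAddTorus (Fin 4) => timeRoll τ u y - ∫ y, u 0 y) :=
      hV.comp_clm complexify.toContinuousLinearMap
    have hV'c : IsSmooth (complexify ∘ fun y : UnitAddTorus (Fin 4) => timeRoll τ' u' y - ∫ y, u' 0 y) :=
      hV'.comp_clm complexify.toContinuousLinearMap
    rw [hsplit, mFourierCoeff_sub hVc.integrable hV'c.integrable, coeW_sub]
    have e1 := congrArg (fun F : ℤ × (Fin 3 → ℤ) → EuclideanSpace ℂ (Fin 3) => F m) hx
    have e2 := congrArg (fun F : ℤ × (Fin 3 → ℤ) → EuclideanSpace ℂ (Fin 3) => F m) hx'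
    simp only at e1 e2
    rw [e1, e2]
    simp only [Pi.sub_apply, smul_sub]
  -- the slice `H¹` bound at circle time `t/τ`
  have hbound := slice_h1_le hD (𝐰 ((x - x' : W))) he0 he he2 (((t / τ : ℝ)) : UnitAddCircle)
  rw [tsum_enorm_sq_toReal_eq (x - x' : W)] at hbound
  have hg : IsSmooth (timeSlice D (((t / τ : ℝ)) : UnitAddCircle)) := hD.timeSlice _
  have hI0 : 0 ≤ ∫ z, ‖timeSlice D (((t / τ : ℝ)) : UnitAddCircle) z‖ ^ 2 :=
    integral_nonneg fun _ => sq_nonneg _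
  have hG0 : 0 ≤ gradNormSq (timeSlice D (((t / τ : ℝ)) : UnitAddCircle)) := gradNormSq_nonneg _
  -- identify the slice with `u(t) − u'(τ't/τ)` up to the constant `∫u(0) − ∫u'(0)`
  have hfun : (fun z => u t z - u' (τ' / τ * t) z) =
      fun z => ((∫ y, u 0 y) - ∫ y, u' 0 y) + timeSlice D (((t / τ : ℝ)) : UnitAddCircle) z := by
    funext z
    rw [timeSlice_apply, hDdef]
    simp only
    rw [timeRoll_cons hper (t / τ) z, timeRoll_cons hper' (t / τ) z,
      show τ * (t / τ) = t by field_simp, show τ' * (t / τ) = τ' / τ * t by ring]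
    abel
  refine ⟨?_, ?_⟩
  · have h1 := integral_norm_sq_const_add_le ((∫ y, u 0 y) - ∫ y, u' 0 y) hg.continuous
    have hfz : ∀ z, u t z - u' (τ' / τ * t) z =
        ((∫ y, u 0 y) - ∫ y, u' 0 y) + timeSlice D (((t / τ : ℝ)) : UnitAddCircle) z := fun z => congrFun hfun z
    simp_rw [hfz]
    linarith
  · rw [hfun, gradNormSq_const_add]
    linarith

end BudgetLimitAux

/-- **stub_budgetLimit** (budgets pass to lattice limits; registered stub of the line
`malkin-cone-group-orbits`, lead c16 reshape "lattice-tempered windows"): let `u` be a jointly smooth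
`τ`-periodic field whose lattice data is `x/Λ`, and `uᵢ` jointly smooth `τᵢ`-periodic fields with
lattice data `xᵢ/Λ`, `xᵢ → x` in `W`, means `∫uᵢ(0) → ∫u(0)`, viscosities `νᵢ → ν > 0`, and budgets
`meanEnergy uᵢ ≤ E`, `ε ≤ meanDissipation νᵢ uᵢ`.  Then `meanEnergy u ≤ E` and `ε ≤ meanDissipation ν u`:
the slice `H¹` bound `TimePeriodicLattice.slice_h1_le` applied to
`D = (timeRoll τ u − ∫u(0)) − (timeRoll τᵢ uᵢ − ∫uᵢ(0))` (coefficients `(x − xᵢ)/Λ`,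
`BudgetLimitAux.close_of_states`) gives, uniformly in time and after the linear time rescaling,
`∫‖u(t) − uᵢ(τᵢt/τ)‖² + ‖∇(u(t) − uᵢ(τᵢt/τ))‖₂² ≤ 2‖∫u(0) − ∫uᵢ(0)‖² + 6(1+4π²)‖x − xᵢ‖² → 0`, and
`PeriodicWindow.meanEnergy_le_of_close` / `meanDissipation_ge_of_close` (with every `η > 0`, then
`η → 0`; `meanDissipation ν uᵢ = (ν/νᵢ) meanDissipation νᵢ uᵢ` by
`PeriodicWindow.meanDissipation_eq_period_mean`) transfer the closed budget inequalities. [folklore] -/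
theorem stub_budgetLimit
    (hW : ∀ x : lp (fun _ : ℤ × (Fin 3 → ℤ) => EuclideanSpace ℂ (Fin 3)) 2, x ∈ W ↔
      (∀ n : ℤ, (x : ℤ × (Fin 3 → ℤ) → EuclideanSpace ℂ (Fin 3)) (n, 0) = 0) ∧
      (∀ mm : ℤ × (Fin 3 → ℤ), (∑ jj : Fin 3, ((mm.2 jj : ℤ) : ℂ) *
        ((x : ℤ × (Fin 3 → ℤ) → EuclideanSpace ℂ (Fin 3)) mm) jj) = 0) ∧
      (∀ mm : ℤ × (Fin 3 → ℤ), (x : ℤ × (Fin 3 → ℤ) → EuclideanSpace ℂ (Fin 3)) (-mm) =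
        conjVec ((x : ℤ × (Fin 3 → ℤ) → EuclideanSpace ℂ (Fin 3)) mm)))
    {τ ν : ℝ} (hτ : 0 < τ) (hν : 0 < ν) {u : ℝ → 𝕋³ → ℝ³} (hu : IsSmoothSpaceTimeOn Set.univ u)
    (hper : Function.Periodic u τ) (x : W) (hx : 𝐨[τ, u] = 𝐜 (𝐰 x))
    (τs νs : ℕ → ℝ) (hτs : ∀ i, 0 < τs i) (hνs : ∀ i, 0 < νs i) (hνl : Tendsto νs atTop (𝓝 ν))
    (us : ℕ → ℝ → 𝕋³ → ℝ³) (hus : ∀ i, IsSmoothSpaceTimeOn Set.univ (us i))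
    (hpers : ∀ i, Function.Periodic (us i) (τs i))
    (xs : ℕ → W) (hxs : ∀ i, 𝐨[τs i, us i] = 𝐜 (𝐰 (xs i))) (hlim : Tendsto xs atTop (𝓝 x))
    (hmean : Tendsto (fun i => ∫ y, us i 0 y) atTop (𝓝 (∫ y, u 0 y)))
    {E ε : ℝ} (hE : ∀ i, meanEnergy (us i) ≤ E) (hε : ∀ i, ε ≤ meanDissipation (νs i) (us i)) :
    meanEnergy u ≤ E ∧ ε ≤ meanDissipation ν u := by
  -- the closeness radii `δᵢ → 0`
  obtain ⟨δ, hδ⟩ : ∃ δ : ℕ → ℝ, δ = fun i =>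
      2 * (3 * (1 + 4 * Real.pi ^ 2) * ‖x - xs i‖ ^ 2) + 2 * ‖(∫ y, u 0 y) - ∫ y, us i 0 y‖ ^ 2 := ⟨_, rfl⟩
  have hδ0 : Tendsto δ atTop (𝓝 0) := by
    have h1 : Tendsto (fun i => ‖x - xs i‖) atTop (𝓝 0) := by
      have h := (tendsto_const_nhds : Tendsto (fun _ : ℕ => x) atTop (𝓝 x)).sub hlim
      rw [sub_self] at h
      simpa using h.norm
    have h2 : Tendsto (fun i => ‖(∫ y, u 0 y) - ∫ y, us i 0 y‖) atTop (𝓝 0) := by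
      have h := (tendsto_const_nhds : Tendsto (fun _ : ℕ => ∫ y, u 0 y) atTop (𝓝 (∫ y, u 0 y))).sub hmean
      rw [sub_self] at h
      simpa using h.norm
    have h3 : Tendsto (fun i => 2 * (3 * (1 + 4 * Real.pi ^ 2) * ‖x - xs i‖ ^ 2) +
        2 * ‖(∫ y, u 0 y) - ∫ y, us i 0 y‖ ^ 2) atTop
        (𝓝 (2 * (3 * (1 + 4 * Real.pi ^ 2) * (0 : ℝ) ^ 2) + 2 * (0 : ℝ) ^ 2)) :=
      (((h1.pow 2).const_mul _).const_mul 2).add ((h2.pow 2).const_mul 2)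
    rw [hδ]
    simpa using h3
  -- uniform-in-time closeness after linear time rescaling
  have hcloseE : ∀ i t, ∫ z, ‖u t z - us i (τs i / τ * t) z‖ ^ 2 ≤ δ i := fun i t => by
    rw [hδ]
    exact (BudgetLimitAux.close_of_states hW hτ hu hper (hus i) (hpers i) x (xs i) hx (hxs i) t).1
  have hcloseD : ∀ i t, gradNormSq (fun z => u t z - us i (τs i / τ * t) z) ≤ δ i := fun i t => by
    have h := (BudgetLimitAux.close_of_states hW hτ hu hper (hus i) (hpers i) x (xs i) hx (hxs i) t).2
    have hA : 0 ≤ 3 * (1 + 4 * Real.pi ^ 2) * ‖x - xs i‖ ^ 2 := by positivity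
    have hB : 0 ≤ ‖(∫ y, u 0 y) - ∫ y, us i 0 y‖ ^ 2 := by positivity
    rw [hδ]
    linarith
  refine ⟨BudgetLimitAux.le_of_forall_le_one_add_mul fun η hη => ?_,
    BudgetLimitAux.le_of_forall_inv_one_add_mul_le fun η hη => ?_⟩
  · -- ENERGY: `⟨‖u‖²⟩ ≤ (1+η)⟨‖uᵢ‖²⟩ + (1+η⁻¹)δᵢ ≤ (1+η)E + (1+η⁻¹)δᵢ → (1+η)E`
    have hlimE : Tendsto (fun i => (1 + η) * E + (1 + η⁻¹) * δ i) atTop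
        (𝓝 ((1 + η) * E + (1 + η⁻¹) * 0)) :=
      tendsto_const_nhds.add (hδ0.const_mul _)
    rw [mul_zero, add_zero] at hlimE
    refine ge_of_tendsto' hlimE fun i => ?_
    have h := PeriodicWindow.meanEnergy_le_of_close (hus i) (hpers i) (hτs i) hu hper hτ hη
      (hcloseE i)
    have h2 : (1 + η) * meanEnergy (us i) ≤ (1 + η) * E :=
      mul_le_mul_of_nonneg_left (hE i) (by linarith)
    linarith
  · -- DISSIPATION:
    -- `(1+η)⁻¹((ν/νᵢ)ε − ν(1+η⁻¹)δᵢ) ≤ (1+η)⁻¹(⟨ν‖∇uᵢ‖²⟩ − ν(1+η⁻¹)δᵢ) ≤ ⟨ν‖∇u‖²⟩`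
    have hq : Tendsto (fun i => ν / νs i) atTop (𝓝 (ν / ν)) :=
      tendsto_const_nhds.div hνl hν.ne'
    rw [div_self hν.ne'] at hq
    have hlimD : Tendsto (fun i => (1 + η)⁻¹ * (ν / νs i * ε - ν * ((1 + η⁻¹) * δ i))) atTop
        (𝓝 ((1 + η)⁻¹ * (1 * ε - ν * ((1 + η⁻¹) * 0)))) :=
      ((hq.mul_const ε).sub ((hδ0.const_mul _).const_mul ν)).const_mul _
    rw [one_mul, mul_zero, mul_zero, sub_zero] at hlimD
    refine le_of_tendsto' hlimD fun i => ?_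
    have h := PeriodicWindow.meanDissipation_ge_of_close (hus i) (hpers i) (hτs i) hu hper hτ hν.le hη
      (hcloseD i)
    have hresc : meanDissipation ν (us i) = (ν / νs i) * meanDissipation (νs i) (us i) :=
      BudgetLimitAux.meanDissipation_rescale (hus i) (hpers i) (hτs i) (hνs i).ne'
    have h2 : ν / νs i * ε ≤ meanDissipation ν (us i) := by
      rw [hresc]
      exact mul_le_mul_of_nonneg_left (hε i) (div_pos hν (hνs i)).le
    have hη1 : 0 ≤ (1 + η)⁻¹ := by positivity
    calc (1 + η)⁻¹ * (ν / νs i * ε - ν * ((1 + η⁻¹) * δ i))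
        ≤ (1 + η)⁻¹ * (meanDissipation ν (us i) - ν * ((1 + η⁻¹) * δ i)) :=
          mul_le_mul_of_nonneg_left (by linarith) hη1
      _ ≤ meanDissipation ν u := h

end Summit.AnomalousDissipation.AnomalousDissipation.Theorems.RobustLoudUpgrade.Tempered

end
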